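import Mathlib
import Summits.Ventures.CertifiedArithmetic.LowPrec.OptSSEWindow
import Summits.Ventures.CertifiedArithmetic.LowPrec.OptInt8Minimax

/-!
# Opt / R4 — Theorem S9(i)(ii): the two-candidate windows for the UNIFORM grid `{0,…,127}` (MXINT8-type): L∞ for every block size, SSE iff `k ≤ 127² + 1 = 16130` (tight)

HONEST FRAMING: certified error envelopes and provably optimal rounding/accumulation schemes for
low-precision formats under stated cost models; every table by two implementations; no hardware or
vendor claims.

OPTIMA.md Theorem S9 (opt seat, pub-lowprec; certificate C11 = `certs/opt/mxint8_{A,B}.json`, two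
implementations, 265 fields, 0 mismatches) transfers the window theorems S3 / S4 from the minifloat element
grids to the uniform magnitude grid `int8 = {0,…,127}` of `OptInt8Minimax.lean` (MXINT8 magnitudes in
units of `2⁻⁶`; the code `-128` excluded by the symmetric convention of FORMATS.md). The generic theorems
`two_candidates` (`OptTwoCandidates.lean`) and `sse_third_scale_wins` (`OptSSEWindow.lean`) apply verbatim
(`T = 127 ∈ int8`, doubling-closed below the top, `1 ∈ int8`, covering radius `u/2 = R u` with
`4 R = 2 ≤ 127`); only the finer-scale SSE comparison needs a uniform-grid replacement for the
coincidence-zone lemma `sq_gain_le_half` (whose hypothesis `2 * Tm = T` fails for odd `T`): here it is the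
one-line consequence `int8_sq_gain_le_half` of the covering radius (`err u y ≤ u/2` below the top, and
clipping errors only grow at finer scales).

* `two_candidates_int8` — S9(i) = Theorem S3 for the uniform grid: with the non-clipping scale `s`
  (`127 s / 2 < a ≤ 127 s`) no coarser power-of-two scale is better in block L∞ error and every
  `s / 2^n`, `n ≥ 2`, is strictly worse — for EVERY block size (`K₁ = 0`).
* `sse_finer_lt_half_int8`, `sse_two_candidates_int8` — S9(ii) = Theorem S4 for the uniform grid: for
  `k ≤ 127² + 1 = 16130`, `min (SSE(2u), SSE(u)) ≤ SSE(v)` for every power-of-two scale `v`.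
* `sse_third_scale_wins_int8` — tightness: for every `k ≥ 16131` and every `u > 0` a block with maximum
  in `(127 u, 254 u]` for which the third scale `u/2` beats `2u`, `u`, every coarser and every finer
  scale (`K₂(INT8) = 16130` exactly; certificate C11 field `I2.K2`).
-/

namespace Summit.Ventures.CertifiedArithmetic.LowPrec.Opt

section Int8Window

variable {K : Type*} [Field K] [LinearOrder K] [IsStrictOrderedRing K] [FloorRing K]

/-- `127 ∈ int8` (the top) -/
theorem int8_top_mem : 127 ∈ int8 := mem_int8.mpr le_rfl

/-- `1 ∈ int8` -/
theorem int8_one_mem : 1 ∈ int8 := mem_int8.mpr (by norm_num)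

/-- the uniform grid is doubling-closed below its top -/
theorem int8_double : ∀ n ∈ int8, 2 * n ≤ 127 → 2 * n ∈ int8 :=
  fun _ _ h => mem_int8.mpr h

/-- **S9(i) = Theorem S3 for the uniform grid `{0,…,127}`: the L∞-optimal power-of-two scale is the
non-clipping scale `s` or its half, for every block size.** -/
theorem two_candidates_int8 {k : ℕ} (x : Fin k → K) {s a : K} (hs : 0 < s) (hx0 : ∀ i, 0 ≤ x i)
    (hxa : ∀ i, x i ≤ a) (ha : a ≤ ((127 : ℕ) : K) * s) (ha' : ((127 : ℕ) : K) * s < 2 * a)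
    (i₀ : Fin k) (hi₀ : x i₀ = a) :
    (∀ n : ℕ, blockErr int8_ne s x i₀ ≤ blockErr int8_ne (2 ^ n * s) x i₀) ∧
    (∀ n : ℕ, 2 ≤ n → blockErr int8_ne s x i₀ < blockErr int8_ne (s / 2 ^ n) x i₀) :=
  two_candidates int8_ne (T := 127) int8_top_mem int8_le int8_double (R := 1 / 2) (by norm_num)
    (fun s y hs hy0 hy => (int8_cov hs hy0 (by simpa using hy)).trans_eq (by ring))
    x hs hx0 hxa ha ha' i₀ hi₀

/-- uniform-grid replacement for `sq_gain_le_half`: going from the scale `u` to any finer scale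
`u / 2^j` an element `y ≥ 0` gains at most `(u/2)²` in squared error (below the top the error at `u`
is already `≤ u/2`; above it the clipping error only grows). -/
theorem int8_sq_gain_le_half {u y : K} (hu : 0 < u) (hy0 : 0 ≤ y) (j : ℕ) :
    err int8_ne u y ^ 2 ≤ err int8_ne (u / 2 ^ j) y ^ 2 + (u / 2) ^ 2 := by
  have hnn : 0 ≤ err int8_ne (u / 2 ^ j) y ^ 2 := sq_nonneg _
  by_cases hy : y ≤ 127 * u
  · have h1 : err int8_ne u y ≤ u / 2 := int8_cov hu hy0 hy
    have h0 : 0 ≤ err int8_ne u y := gridDist_nonneg _ _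
    nlinarith
  · have hy' : ((127 : ℕ) : K) * u ≤ y := by push_cast; linarith [lt_of_not_ge hy]
    have e1 : err int8_ne u y = y - ((127 : ℕ) : K) * u :=
      err_eq_sub_top int8_ne int8_top_mem int8_le hu.le hy'
    have h2 : y - ((127 : ℕ) : K) * (u / 2 ^ j) ≤ err int8_ne (u / 2 ^ j) y :=
      sub_top_le_err int8_ne int8_le (by positivity) y
    have hj1 : (1 : K) ≤ 2 ^ j := one_le_pow₀ (by norm_num)
    have h3 : u / 2 ^ j ≤ u := by
      rw [div_le_iff₀ (by positivity)]; nlinarith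
    have h4 : 0 ≤ y - ((127 : ℕ) : K) * u := by linarith
    have h5 : y - ((127 : ℕ) : K) * u ≤ err int8_ne (u / 2 ^ j) y := by
      push_cast at h2 ⊢; nlinarith
    rw [e1]
    nlinarith [pow_le_pow_left₀ h4 h5 2]

/-- **S9(ii), the finer-scale comparison for the uniform grid**: if the maximum clips at scale `u`
(`127 u < a`) and `k ≤ 127² + 1`, every finer scale `u / 2^j`, `j ≥ 1`, has strictly larger block SSE
than `u` (the maximum alone loses more than `127² (u/2)²`, `top_sq_loss`; the others gain `≤ (u/2)²` each). -/
theorem sse_finer_lt_half_int8 {k : ℕ} (x : Fin k → K) {u a : K} (hu : 0 < u) (hx0 : ∀ i, 0 ≤ x i)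
    (ha' : ((127 : ℕ) : K) * u < a) (i₀ : Fin k) (hi₀ : x i₀ = a) (hk : k ≤ 127 ^ 2 + 1) {j : ℕ}
    (hj : 1 ≤ j) : blockSSE int8_ne u x < blockSSE int8_ne (u / 2 ^ j) x := by
  have hk1 : 1 ≤ k := Fin.pos i₀
  have htop := top_sq_loss int8_ne (T := 127) int8_top_mem int8_le (by norm_num) hu ha' hj
  have hrest : ∀ i, err int8_ne u (x i) ^ 2 ≤ err int8_ne (u / 2 ^ j) (x i) ^ 2 + (u / 2) ^ 2 :=
    fun i => int8_sq_gain_le_half hu (hx0 i) j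
  have hsum : ∑ i ∈ Finset.univ.erase i₀, err int8_ne u (x i) ^ 2 ≤
      ∑ i ∈ Finset.univ.erase i₀, err int8_ne (u / 2 ^ j) (x i) ^ 2 + ((k : K) - 1) * (u / 2) ^ 2 := by
    have h := Finset.sum_le_sum (fun i (_ : i ∈ Finset.univ.erase i₀) => hrest i)
    rw [Finset.sum_add_distrib, Finset.sum_const, Finset.card_erase_of_mem (Finset.mem_univ _),
      Finset.card_univ, Fintype.card_fin, nsmul_eq_mul, Nat.cast_sub hk1, Nat.cast_one] at h
    exact h
  have hkT : ((k : K) - 1) * (u / 2) ^ 2 ≤ (((127 : ℕ) : K)) ^ 2 * (u / 2) ^ 2 := by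
    have : (k : K) ≤ (((127 : ℕ) : K)) ^ 2 + 1 := by exact_mod_cast hk
    exact mul_le_mul_of_nonneg_right (by linarith) (by positivity)
  have e1 : blockSSE int8_ne u x =
      err int8_ne u a ^ 2 + ∑ i ∈ Finset.univ.erase i₀, err int8_ne u (x i) ^ 2 := by
    unfold blockSSE
    rw [← Finset.add_sum_erase _ _ (Finset.mem_univ i₀), hi₀]
  have e2 : blockSSE int8_ne (u / 2 ^ j) x =
      err int8_ne (u / 2 ^ j) a ^ 2 + ∑ i ∈ Finset.univ.erase i₀, err int8_ne (u / 2 ^ j) (x i) ^ 2 := by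
    unfold blockSSE
    rw [← Finset.add_sum_erase _ _ (Finset.mem_univ i₀), hi₀]
  rw [e1, e2]
  linarith

/-- **S9(ii) = Theorem S4 for the uniform grid (`K₂ = 127² + 1 = 16130`): for `k ≤ 16130` the two
candidates suffice for block SSE** — with the non-clipping scale `2u` (`127 u < a ≤ 254 u`), every
power-of-two scale `v` has `min (SSE(2u), SSE(u)) ≤ SSE(v)`. -/
theorem sse_two_candidates_int8 {k : ℕ} (x : Fin k → K) {u a : K} (hu : 0 < u) (hx0 : ∀ i, 0 ≤ x i)
    (hxa : ∀ i, x i ≤ a) (ha : a ≤ ((127 : ℕ) : K) * (2 * u)) (ha' : ((127 : ℕ) : K) * u < a)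
    (i₀ : Fin k) (hi₀ : x i₀ = a) (hk : k ≤ 16130) (v : K)
    (hv : (∃ n : ℕ, v = 2 ^ n * (2 * u)) ∨ v = u ∨ (∃ n : ℕ, 2 ≤ n ∧ v = 2 * u / 2 ^ n)) :
    min (blockSSE int8_ne (2 * u) x) (blockSSE int8_ne u x) ≤ blockSSE int8_ne v x := by
  rcases hv with ⟨n, rfl⟩ | rfl | ⟨n, hn, rfl⟩
  · have hxT : ∀ i, x i ≤ ((127 : ℕ) : K) * (2 * u) := fun i => (hxa i).trans ha
    exact (min_le_left _ _).trans
      (sse_coarser_le int8_ne int8_top_mem int8_double x (by positivity) hxT n)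
  · exact min_le_right _ _
  · obtain ⟨j, rfl⟩ := Nat.exists_eq_add_of_le hn
    have e : 2 * u / 2 ^ (2 + j) = u / 2 ^ (1 + j) := by
      rw [div_eq_div_iff (by positivity) (by positivity)]; ring
    rw [e]
    exact (min_le_right _ _).trans
      (sse_finer_lt_half_int8 x hu hx0 ha' i₀ hi₀ (hk.trans (by norm_num)) (j := 1 + j) (by omega)).le

omit [FloorRing K] in
/-- **S9(ii), tightness: `K₂(INT8) = 16130` is exact** — for every block size `k ≥ 16131` and every
`u > 0` the third scale `u/2` wins on an explicit block (generic `sse_third_scale_wins`). -/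
theorem sse_third_scale_wins_int8 {k : ℕ} (hk : 16131 ≤ k) {u : K} (hu : 0 < u) :
    ∃ (x : Fin k → K) (i₀ : Fin k), (∀ i, 0 ≤ x i) ∧ (∀ i, x i ≤ x i₀) ∧
      ((127 : ℕ) : K) * u < x i₀ ∧ x i₀ ≤ ((127 : ℕ) : K) * (2 * u) ∧
      blockSSE int8_ne (u / 2) x < blockSSE int8_ne (2 * u) x ∧
      blockSSE int8_ne (u / 2) x < blockSSE int8_ne u x ∧
      (∀ n : ℕ, blockSSE int8_ne (u / 2) x < blockSSE int8_ne (2 ^ n * (2 * u)) x) ∧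
      (∀ j : ℕ, 2 ≤ j → blockSSE int8_ne (u / 2) x < blockSSE int8_ne (u / 2 ^ j) x) :=
  sse_third_scale_wins int8_ne (T := 127) int8_top_mem int8_le int8_one_mem (by norm_num)
    int8_double (le_trans (by norm_num) hk) hu

end Int8Window

end Summit.Ventures.CertifiedArithmetic.LowPrec.Opt
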